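import Summits.HodgeConjecture.HodgeConjecture.Theorems.F0P3SpectralPacketFactorisationPkOnSigned          -- ★ 3x′-S: the ★ original and its whole import cone (★ 3x′, `kitOfRecord`, `ghOfFibres`, ★ v8 `FactorisationPk`, `hat₀`, ★ 3u‴ zero branch)
import Summits.HodgeConjecture.HodgeConjecture.Theorems.F0P3SpectralPacketPresentationBridgeOnSignedOffS  -- (this seat) (uH5″)∕S₀, (z2″)∕S₀ over `trHOn S₀` (+ ★ p863491 `…BridgeOnOffS`, ★ LH7-typ2 `…HTraceOn`)
import Summits.HodgeConjecture.HodgeConjecture.Theorems.F0P3SpectralPacketTraceOnLawsOffS              -- ★ p863490 (this seat): `unramTraceOneOff_map_of_map_eq_offS`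
import HarnessLib

/-!
# (N) FILE 3x′-S∕S₀ — CLAUSE (P1) `FactorisationPk` AT THE TUPLE WITH THE SIGNED `H`-SIDE LAW, THE `H`-TRACE SLOT FLOORED AT `S₀` (`trHOn S₀`) AND THE LAWS (ℓ4) ∕ (TF-1)-H READ ONLY
# OFF `S₀` (F13 «JQ-RAM» WP1 (5), K9 lane HEAD: additive `_offS` sibling of ★ 3x′-S `F0P3SpectralPacketFactorisationPkOnSigned` :95 — the T-B junction's (P1) term :237)
# (Rogawski §14.6 pp. 242–244; §13.7 pp. 210–212; (14.2.1) pp. 232–233; §14.3; p. 243 l. 9–17; §4.3 p. 44)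

Cell `hodgecm-mathlib` (D-0151), F0∕P3 «U3-mult», crux H413 (`stmt-HodgeConjecture-24833`), route of record `HCCMUnconditional`; programme R90-TF, F13 «JQ-RAM» repair
(director M-159∕M-159b∕M-159c; heir LEAD F0P3a-plan (g22) T21-11 WP1 (5) «the K9 side, the long pole», T21-13 (1) §3′ r2, T21-14 (2), T21-16 (R-41) «JQ-RAM-T SPELLING» (S3) «T-B
:205∕:243∕:253 `fun ρ => ρ.trHOn S₀ νH archTrH`, :189 `h1H : ∀ ρ, ρ.UnramTraceOneHOff S₀ νH`»; R90-TF LEAD K2E1-plan (g8) LEAD #38 F13-SCOPE memo 7a2d5558a063a1f1, LEAD #39 (A) r2,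
LEAD #43 (B) §3′ r3; ref4 (g13) R4-175 (B) «`FactorisationPkOnSigned.factorisationPk_kitOfRecord_homOn_signed` → {`trH…off_signed`, `trH_zero…signed`, `trOn…eval_eq`, `trOn_zero…`,
`unramTraceOneOff_map_of_map_eq`} — NOT `PkOnG`∕`PkG`»; LH7-typ1 (g3) 2026-09-05T00:11:19Z (2)(d) «(P1) :237–:239 ↦ WP1 (5) `…FactorisationPkOnSignedOffS` head»).  Seat: S7 prover
R90-C146-p01 (g2) (✋ WP1 (5), LH4 bus 2026-09-04T23:49Z).  PROOF lane (`--kind proof --supports stmt-HodgeConjecture-24833 --as helper`): ONE theorem; no `def`, no instance, no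
notation, no named fact, no `sorry`; never imports a `Cruxes/…/Lines` module; ★ 3x′-S UNTOUCHED (rule 69; its §2 `hTraceProductForm_ghOfFibres_const_mul` is slot-generic and needs no twin).

WHY (F13) and SHAPE.  Under (R-39)″ ∕ (R-41): (KG1′) is uninhabitable kit-wide at ramified `v` and (KH3′)♭ yields only the `S₀`-guarded (TF-1)-H; the (T) row and the K9 `H`-trace slot are
floored at `S₀ ⊇ RamL`.  This head is ★ 3x′-S with: the Sockets tuple's `H`-slot `fun ρ => ρ.trH νH archTrH` ↦ `fun ρ => ρ.trHOn S₀ νH archTrH` (4 sites: `htens`, `htensH`, conclusion ×2;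
`S₀` is bound BEFORE them); `h4 : ∀ v ∉ S₀, (𝔩 v).UnramLaw` and `h1H : ∀ ρ, ρ.UnramTraceOneHOff S₀ νH` moved right after `hψK`; the derived (TF-1)∕S₀ via ★ `unramTraceOneOff_map_of_map_eq_offS`,
(TF-ind)∕S₀ via ★ 3y `presentationIndepOn_of_admissible` (unchanged); the four (P1) branches via ★ `trOn_partner_eq_trSψ_mul_prod_of_eval_eq_offS` ∕ ★ 3u‴ `trOn_partner_eq_zero_…` (no law
moved) ∕ `trH_partner_eq_trHSψ_mul_prod_of_eval_eq_off_signed_offS` ∕ `trH_partner_eq_zero_of_not_ramFinsetH_subset_of_eval_eq_signed_offS`.  Everything else VERBATIM.  T-B ED. 6 :237: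
`SpectralPacketG.factorisationPk_kitOfRecord_homOn_signed_offS ι T hT μ 𝔨.traceGp 𝔨.Smooth 𝔨.Matches μω (…) jInf dsInf archTr' ν hνA νG _ infOf aTok _ (nH) _ νH archTrG archTrH 𝔨.ψ hνl hνc
hKG2 hKG3 hKH1 S₀ hgood hψK h4 h1H hvol' hKG6 harch0 hKH5 …` (i.e. ★'s argument list with `hKG1` and `h1H` REMOVED from before `S₀` and `h4 h1H` INSERTED after `hψK`).

HONEST LABEL: count-neutral repair twin; it pays no socket and no citation and nothing on the counted path until the F13 window (T-A ED. 6 + T-B ED. 6 + leaf ED. 7 + AGG) is BUILT.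
HC_CM is proved only modulo the 7 printed citations (2 remaining named inputs: hLiu418 = stmt-HodgeConjecture-24832, h413 = stmt-HodgeConjecture-24833) until rung 0 closes; STANDING
DEFECT M-159∕b∕c «JQ-RAM».

References: [Rogawski1990] §14.6 pp. 242–244, p. 243 l. 9–17; §13.2 pp. 199–200; §13.7 pp. 210–212; §14.2 (14.2.1) pp. 232–233; §14.3 p. 233; §14.4 Prop. 14.4.1 (c), 14.4.2 pp. 235–236;
§4.3 p. 44; §5.4 p. 72.  [FlathCorvallis1979] Thm. 3.  [CartierCorvallis1979] §IV.1 Cor. 4.1.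
-/

set_option autoImplicit false
-- the mandated namespace repeats `HodgeConjecture.HodgeConjecture`, as in every `Theorems/*.lean` of this sub-problem
set_option linter.dupNamespace false

noncomputable section

open NumberField IsDedekindDomain MeasureTheory
open scoped Matrix MatrixGroups

open Literature.NumberTheory Literature.NumberTheory.Automorphic Literature.NumberTheory.Automorphic.UnitaryGroup
open Literature.NumberTheory.Rogawski1990 Literature.NumberTheory.GaloisRepresentations
open Literature.RepresentationTheory.BorelWallach2000 Literature.RepresentationTheory.KonnoKonno2007
open Summit.HodgeConjecture.HodgeConjecture.Cruxes.H413.F0P3InnerFormClassificationV6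
open Summit.HodgeConjecture.HodgeConjecture.Cruxes.H413.F0P3LocalPacketKit
open Summit.HodgeConjecture.HodgeConjecture.Cruxes.H413.F0P3ArchPacketKit
open Summit.HodgeConjecture.HodgeConjecture.Cruxes.H413.F0P3SemilocalTestFunctionsOfRecord (TestS₀ tens₀ toPureTensor coe_tens₀)
open Summit.HodgeConjecture.HodgeConjecture.Cruxes.H413.F0P3TestFunctionsOfRecord (Unr₀ hat₀)
open Summit.HodgeConjecture.HodgeConjecture.Cruxes.H413.F0P3UnrTensorInstance (UnrTensor)
open Summit.HodgeConjecture.HodgeConjecture.Cruxes.H413.F0P3KitOfRecord (GHSide XiSide kitOfRecord)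
open Summit.HodgeConjecture.HodgeConjecture.Cruxes.H413.F0P3GHSideOfFibres (ghOfFibres matches_tensG_tensH)

namespace Summit.HodgeConjecture.HodgeConjecture.Cruxes.H413.F0P3SpectralPacket.SpectralPacketG

open Summit.HodgeConjecture.HodgeConjecture.Cruxes.H413.F0P3GlobalPacket
open Summit.HodgeConjecture.HodgeConjecture.Cruxes.H413.F0P3ArchPacketKit.ArchPacketKitH

variable {L : Type} [Field L] [NumberField L] [IsCMField L] {H : Matrix (Fin 3) (Fin 3) L}
  -- the frame, T1's sockets other than the packet types, and `kitOfRecord`'s remaining parameters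
  (ι : L →+* ℂ) (T : GL (Fin 3) ℂ)
  (hT : (T : Matrix (Fin 3) (Fin 3) ℂ)ᴴ * H.map ι * (T : Matrix (Fin 3) (Fin 3) ℂ) = Literature.Geometry.ComplexHyperbolic.BallModel.J)
  (μGp : Measure (Gp L H).automorphicQuotient) [(Gp L H).IsAutomorphicMeasure μGp]
  (traceGp : TestGp L H →ₗ[ℂ] ℂ) (Smooth : TestGp L H → Prop) (Matches : TestGp L H → TestG L → TestH L → Prop)
  (μω : HeckeCharacter L) (c : ℚ) (jInf dsInf : ℤ → ℤ → ℤ → Cinf)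
  (archTr : Cinf → (UnitaryGroup.arch (↥(maximalRealSubfield L)) L (IsCMField.complexConj L) 3 H → ℂ) → ℂ)
  -- the adelic Haar measure in the LETTER's typing (`borel`-based, instances re-introduced by `letI` as in `K9SpectralLetterSigned` — so the conclusion matches the letter's clause up to `rfl`)
  (νA : @Measure (Gp L H).Adelic (borel _)) (hνA : letI : MeasurableSpace (Gp L H).Adelic := borel _; IsFiniteMeasureOnCompacts νA)
  (νG : ∀ v : Places L, @Measure ((cmDatum L 3 H).Local v) (borel _))
  (ramCls₀ : DiscreteAutomorphicRep (Gp L H) μGp → Set (Places L))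
  -- the (N) kits and slots
  {𝔩 : ∀ v : HeightOneSpectrum (𝓞 ↥(maximalRealSubfield L)), LocalPacketKit L (splitForm L 3) v} {𝔞 : ArchPacketKit} {𝔞H : ArchPacketKitH 𝔞}
  {DiscH : GlobalPacketH 𝔩 → 𝔞H.PktInfH → Prop}
  {μ : Measure (adelicGroupData (↥(maximalRealSubfield L)) L (IsCMField.complexConj L) 3 (splitForm L 3)).automorphicQuotient}
  [SMulInvariantMeasure (adelicGroupData (↥(maximalRealSubfield L)) L (IsCMField.complexConj L) 3 (splitForm L 3)).Adelic
    (adelicGroupData (↥(maximalRealSubfield L)) L (IsCMField.complexConj L) 3 (splitForm L 3)).automorphicQuotient μ]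
  [∀ v : HeightOneSpectrum (𝓞 ↥(maximalRealSubfield L)), MeasurableSpace ((cmDatum L 3 (splitForm L 3)).Local v)]
  [∀ v : HeightOneSpectrum (𝓞 ↥(maximalRealSubfield L)), BorelSpace ((cmDatum L 3 (splitForm L 3)).Local v)]
  [∀ v : HeightOneSpectrum (𝓞 ↥(maximalRealSubfield L)), MeasurableSpace ((cmDatum L 2 (splitForm L 2)).Local v × (cmDatum L 1 (splitForm L 1)).Local v)]
  [∀ v : HeightOneSpectrum (𝓞 ↥(maximalRealSubfield L)), BorelSpace ((cmDatum L 2 (splitForm L 2)).Local v × (cmDatum L 1 (splitForm L 1)).Local v)]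
  (infOf : GlobalPacket 𝔩 → 𝔞.PktInf) (aTok : ∀ v : HeightOneSpectrum (𝓞 ↥(maximalRealSubfield L)), Set (𝔩 v).Pkt)
  (nG : HomogPacketG 𝔩 𝔞 μ infOf aTok → ℂ) (nH : SpectralPacketH 𝔩 𝔞 𝔞H DiscH → ℂ)
  (ξd : XiSide L H (HomogPacketG 𝔩 𝔞 μ infOf aTok) (SpectralPacketH 𝔩 𝔞 𝔞H DiscH))
  (νH : ∀ v : HeightOneSpectrum (𝓞 ↥(maximalRealSubfield L)), Measure ((cmDatum L 2 (splitForm L 2)).Local v × (cmDatum L 1 (splitForm L 1)).Local v))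
  [∀ v, (νH v).IsMulLeftInvariant] [∀ v, IsFiniteMeasureOnCompacts (νH v)]
  (archTrG : Cinf → (UnitaryGroup.arch (↥(maximalRealSubfield L)) L (IsCMField.complexConj L) 3 (splitForm L 3) → ℂ) → ℂ)
  (archTrH : 𝔞H.CinfH → (UnitaryGroup.arch (↥(maximalRealSubfield L)) L (IsCMField.complexConj L) 2 (splitForm L 2) × UnitaryGroup.arch (↥(maximalRealSubfield L)) L (IsCMField.complexConj L) 1 (splitForm L 1) → ℂ) → ℂ)


/-- **(P1) `FactorisationPk` OF LETTER K9-STF AT THE HOMOGENEOUS COHERENT TUPLE, SIGNED H-SIDE (K2″), H-TRACE SLOT FLOORED AT `S₀` AND (ℓ4) ∕ (TF-1)-H READ ONLY OFF `S₀`** (twin of ★ 3x′-S `factorisationPk_kitOfRecord_homOn_signed`: the Sockets tuple's H-slot is `fun ρ => ρ.trHOn S₀ νH archTrH` ((R-41) (S3)) in `htens`, `htensH` AND the conclusion; `h4 : ∀ v ∉ S₀, (𝔩 v).UnramLaw` and `h1H : ∀ ρ, ρ.UnramTraceOneHOff S₀ νH` bound right after `hψK`; the four branches call ★ `…_offS`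 siblings) (= ★ 3x′ `factorisationPk_kitOfRecord_homOn` with the finite-place law (o1)
`CharIdentityψ` replaced by the SIGNED law (KT2″) ★ `SpectralPacketH.CharIdentityψS … s` (unfolded) for a place-wise sign `s` with finite support `Sbad`, and the socket's `H`-side
`S`-trace slot SCALED BY THE FRAME CONSTANT `σ : ℚ` with `(σ : ℂ) = ∏_{v ∈ Sbad} s_v` (`hσ`; `trHS := fun S ρ f′_S => σ · ρ.trHSψ …`): every finite place contributes its sign to `Tr ρ(f′^H)` (★ 3u″-S
`trH_partner_eq_trHSψ_mul_prod_of_eval_eq_off_signed`), so «`Tr ρ(f′^H) = trHS S ρ f′_S · f^{S∧}(t(ρ))`» holds at the scaled slot and `0` on the ramified branch (★ 3u″-S zero twin); the two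
`G`-branches are VERBATIM.  Print: the inner form's fixed local transfer factors differ from the transported ones by signs `c_v`, `c = ∏ c_v`, carried outside the canonical pairing
[Rogawski1990 §14.6 pp. 242–244]; LEAD F0P3a-plan (g13) T12-13 «K2″» (repair (R-b) of FLAG F10); census `F0/P3c/LH7/LH7-p02/g0/CENSUS-TB-KG1-sign-consumption.v1.md` §D.  The T-B junction ED. 3
instantiates `s := formSignAt L H` (LH7-p01 Δ1) with `Sbad` from ★ `exists_finset_forall_formSignAt_eq_one`, and absorbs `σ` into K9's outer sign `c′ := σ·c`.
[cite: FlathCorvallis1979, Thm. 3] [cite: CartierCorvallis1979, §IV.1 Cor. 4.1] [cite: Rogawski1990, §13.7 pp. 210–212; §14.2 (14.2.1) pp. 232–233; §14.3 p. 233; §14.6 pp. 242–244, p. 243 l. 9–17; §4.3 p. 44] -/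
theorem factorisationPk_kitOfRecord_homOn_signed_offS
    (ψ : ∀ v : HeightOneSpectrum (𝓞 ↥(maximalRealSubfield L)), (cmDatum L 3 H).Local v ≃ₜ* (cmDatum L 3 (splitForm L 3)).Local v)
    (hνl : ∀ v : HeightOneSpectrum (𝓞 ↥(maximalRealSubfield L)), letI : ∀ v : HeightOneSpectrum (𝓞 ↥(maximalRealSubfield L)), MeasurableSpace ((cmDatum L 3 H).Local v) := fun _ => borel _; (νG v).IsMulLeftInvariant)
    (hνc : ∀ v : HeightOneSpectrum (𝓞 ↥(maximalRealSubfield L)), letI : ∀ v : HeightOneSpectrum (𝓞 ↥(maximalRealSubfield L)), MeasurableSpace ((cmDatum L 3 H).Local v) := fun _ => borel _; IsFiniteMeasureOnCompacts (νG v))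
    -- kit laws ((ℓ9), admissibility; (ℓ4) and (TF-1)-H∕S₀ come AFTER `S₀ hgood hψK`, read only off `S₀`; (TF-1)∕S₀ and (TF-ind)∕S₀ are derived below)
    (hU : ∀ v : HeightOneSpectrum (𝓞 ↥(maximalRealSubfield L)), UnrDefLaw (𝔩 v))
    (hadm : ∀ (v : HeightOneSpectrum (𝓞 ↥(maximalRealSubfield L))) (P : (𝔩 v).Pkt), ∀ π ∈ (𝔩 v).mem P, π.IsAdmissible)
    (hadmH : ∀ (v : HeightOneSpectrum (𝓞 ↥(maximalRealSubfield L))) (ρ : (𝔩 v).PktH), ∀ σ ∈ (𝔩 v).memH ρ, σ.IsAdmissible)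
    (S₀ : Finset (HeightOneSpectrum (𝓞 ↥(maximalRealSubfield L))))
    (hgood : ∀ v ∉ S₀, ∀ r : SmoothIrrep ((UnitaryGroup.cmDatum L 3 (splitForm L 3)).Local v), r.ρ.IsAdmissible →
      Module.finrank ℂ (r.ρ.fixedPoints (cmLocalIntegralLevel L 3 (splitForm L 3) v)) ≤ 1)
    (hψK : ∀ v ∉ S₀, (cmLocalIntegralLevel L 3 H v).map (ψ v : (cmDatum L 3 H).Local v →* (cmDatum L 3 (splitForm L 3)).Local v) =
      cmLocalIntegralLevel L 3 (splitForm L 3) v)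
    (h4 : ∀ v ∉ S₀, (𝔩 v).UnramLaw)
    (h1H : ∀ ρ : SpectralPacketH 𝔩 𝔞 𝔞H DiscH, ρ.UnramTraceOneHOff S₀ νH)
    (hvol : ∀ v : HeightOneSpectrum (𝓞 ↥(maximalRealSubfield L)), (νG v).real (cmLocalIntegralLevel L 3 H v : Set ((cmDatum L 3 H).Local v)) = 1)
    -- homogeneity of the archimedean characters (`archTrG` on `G_∞` NEW: feeds ★ 3y `presentationIndepOn_of_admissible`)
    (harchG : ∀ (a : Cinf) (k : ℂ) (f : UnitaryGroup.arch (↥(maximalRealSubfield L)) L (IsCMField.complexConj L) 3 (splitForm L 3) → ℂ), archTrG a (k • f) = k * archTrG a f)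
    (harch' : ∀ (a : Cinf) (k : ℂ) (f : UnitaryGroup.arch (↥(maximalRealSubfield L)) L (IsCMField.complexConj L) 3 H → ℂ), archTr a (k • f) = k * archTr a f)
    (harchH : ∀ (a : 𝔞H.CinfH) (k : ℂ) (f : UnitaryGroup.arch (↥(maximalRealSubfield L)) L (IsCMField.complexConj L) 2 (splitForm L 2) × UnitaryGroup.arch (↥(maximalRealSubfield L)) L (IsCMField.complexConj L) 1 (splitForm L 1) → ℂ), archTrH a (k • f) = k * archTrH a f)
    -- the GUARDED transfer laws (m3) (o1) (o6) at the pin's orbital families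
    (m' : letI : ∀ γ : UnitaryGroup.arch (↥(maximalRealSubfield L)) L (IsCMField.complexConj L) 3 H,
        MeasurableSpace (UnitaryGroup.arch (↥(maximalRealSubfield L)) L (IsCMField.complexConj L) 3 H ⧸
          Subgroup.centralizer ({γ} : Set (UnitaryGroup.arch (↥(maximalRealSubfield L)) L (IsCMField.complexConj L) 3 H))) := fun _ => borel _;
      OrbitalMeasureFamily (UnitaryGroup.arch (↥(maximalRealSubfield L)) L (IsCMField.complexConj L) 3 H))
    (m : letI : ∀ γ : UnitaryGroup.arch (↥(maximalRealSubfield L)) L (IsCMField.complexConj L) 3 (splitForm L 3),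
        MeasurableSpace (UnitaryGroup.arch (↥(maximalRealSubfield L)) L (IsCMField.complexConj L) 3 (splitForm L 3) ⧸
          Subgroup.centralizer ({γ} : Set (UnitaryGroup.arch (↥(maximalRealSubfield L)) L (IsCMField.complexConj L) 3 (splitForm L 3)))) := fun _ => borel _;
      OrbitalMeasureFamily (UnitaryGroup.arch (↥(maximalRealSubfield L)) L (IsCMField.complexConj L) 3 (splitForm L 3)))
    (hlaw : 𝔞.InnerTransferLawTest L H m' m archTrG archTr)
    {Δ' : ∀ v : HeightOneSpectrum (𝓞 ↥(maximalRealSubfield L)), LocalTransferFactor L H v}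
    (mH : letI : ∀ (v : HeightOneSpectrum (𝓞 ↥(maximalRealSubfield L))) (a : (cmDatum L 2 (splitForm L 2)).Local v × (cmDatum L 1 (splitForm L 1)).Local v), MeasurableSpace (((cmDatum L 2 (splitForm L 2)).Local v × (cmDatum L 1 (splitForm L 1)).Local v) ⧸ Subgroup.centralizer ({a} : Set ((cmDatum L 2 (splitForm L 2)).Local v × (cmDatum L 1 (splitForm L 1)).Local v))) := fun _ _ => borel _;
      ∀ v : HeightOneSpectrum (𝓞 ↥(maximalRealSubfield L)), OrbitalMeasureFamily ((cmDatum L 2 (splitForm L 2)).Local v × (cmDatum L 1 (splitForm L 1)).Local v))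
    (mG' : letI : ∀ (v : HeightOneSpectrum (𝓞 ↥(maximalRealSubfield L))) (γ : (cmDatum L 3 H).Local v), MeasurableSpace ((cmDatum L 3 H).Local v ⧸ Subgroup.centralizer ({γ} : Set ((cmDatum L 3 H).Local v))) := fun _ _ => borel _;
      ∀ v : HeightOneSpectrum (𝓞 ↥(maximalRealSubfield L)), OrbitalMeasureFamily ((cmDatum L 3 H).Local v))
    -- (KT2″) the SIGNED finite-place law (★ `SpectralPacketH.CharIdentityψS … s` unfolded), for a place-wise sign `s` supported in the finite set `Sbad` (LEAD T12-13 «K2″»; print's `c_v`, pp. 242–244)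
    (s : HeightOneSpectrum (𝓞 ↥(maximalRealSubfield L)) → ℤ) (Sbad : Finset (HeightOneSpectrum (𝓞 ↥(maximalRealSubfield L)))) (hs : ∀ v ∉ Sbad, s v = 1)
    -- the FRAME CONSTANT `σ = ∏_{v ∈ Sbad} s_v` as a rational number (it multiplies K9's outer sign `c : ℚ`) with its complex reading
    (σ : ℚ) (hσ : (σ : ℂ) = ∏ v ∈ Sbad, (s v : ℂ))
    (hlawψ : letI : ∀ v : HeightOneSpectrum (𝓞 ↥(maximalRealSubfield L)), MeasurableSpace ((cmDatum L 3 H).Local v) := fun _ => borel _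
      letI : ∀ (v : HeightOneSpectrum (𝓞 ↥(maximalRealSubfield L))) (a : (cmDatum L 2 (splitForm L 2)).Local v × (cmDatum L 1 (splitForm L 1)).Local v), MeasurableSpace (((cmDatum L 2 (splitForm L 2)).Local v × (cmDatum L 1 (splitForm L 1)).Local v) ⧸ Subgroup.centralizer ({a} : Set ((cmDatum L 2 (splitForm L 2)).Local v × (cmDatum L 1 (splitForm L 1)).Local v))) := fun _ _ => borel _
      letI : ∀ (v : HeightOneSpectrum (𝓞 ↥(maximalRealSubfield L))) (γ : (cmDatum L 3 H).Local v), MeasurableSpace ((cmDatum L 3 H).Local v ⧸ Subgroup.centralizer ({γ} : Set ((cmDatum L 3 H).Local v))) := fun _ _ => borel _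
      ∀ (ρ : SpectralPacketH 𝔩 𝔞 𝔞H DiscH) (v : HeightOneSpectrum (𝓞 ↥(maximalRealSubfield L)))
        (fH : (cmDatum L 2 (splitForm L 2)).Local v × (cmDatum L 1 (splitForm L 1)).Local v → ℂ) (f' : (cmDatum L 3 H).Local v → ℂ),
        IsLocSmooth fH → IsLocSmooth f' → IsLocalDeltaTransfer L H v (Δ' v) (mH v) (mG' v) fH f' →
          (𝔩 v).trPktH (νH v) (ρ.fin.loc v) fH = (s v : ℂ) * (𝔩 v).endoTrPkt (@Measure.map _ _ (borel _) _ (ψ v) (νG v)) (ρ.fin.loc v) (f' ∘ (ψ v).symm))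
    {Tinf : ArchTransferFactor L H}
    (mHi : letI : ∀ a : UnitaryGroup.arch (↥(maximalRealSubfield L)) L (IsCMField.complexConj L) 2 (splitForm L 2) × UnitaryGroup.arch (↥(maximalRealSubfield L)) L (IsCMField.complexConj L) 1 (splitForm L 1), MeasurableSpace ((UnitaryGroup.arch (↥(maximalRealSubfield L)) L (IsCMField.complexConj L) 2 (splitForm L 2) × UnitaryGroup.arch (↥(maximalRealSubfield L)) L (IsCMField.complexConj L) 1 (splitForm L 1)) ⧸ Subgroup.centralizer ({a} : Set (UnitaryGroup.arch (↥(maximalRealSubfield L)) L (IsCMField.complexConj L) 2 (splitForm L 2) × UnitaryGroup.arch (↥(maximalRealSubfield L)) L (IsCMField.complexConj L) 1 (splitForm L 1)))) := fun _ => borel _;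
      OrbitalMeasureFamily (UnitaryGroup.arch (↥(maximalRealSubfield L)) L (IsCMField.complexConj L) 2 (splitForm L 2) × UnitaryGroup.arch (↥(maximalRealSubfield L)) L (IsCMField.complexConj L) 1 (splitForm L 1)))
    (hlawInf : 𝔞H.EndoTransferLawTest L H Tinf mHi m' archTrH archTr)
    -- the letter's socket-level `hg`∕`hsm`, and the ξ-side read-backs
    (hg : ∀ f' : TestGp L H, Smooth f' → ∃ (f : TestG L) (fH : TestH L), Matches f' f fH)
    (hsm : ∀ (S : Finset (Places L)) (fS : TestS₀ L H ι T hT S) (fT : Unr₀ L H S), Smooth (tens₀ S fS fT))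
    (hξG : ∀ Q, ξd.evpG Q = Q.1.evpGψ ψ (fun v => @Measure.map _ _ (borel _) _ (ψ v) (νG v))) (hξH : ∀ ρ, ξd.evpH ρ = ρ.evpHψ ψ (fun v => @Measure.map _ _ (borel _) _ (ψ v) (νG v)))
    (hξrG : ∀ Q, ξd.ramG Q = Q.1.fin.ramFinset) (hξrH : ∀ ρ, ξd.ramH ρ = ρ.ramFinsetH)
    -- the pins' tensor witnesses at the record tensors (pin (ix′) `transfer_tensors`, pin (xi″-c) `deltaTransfer`, read through ★ `matches_tensG_tensH` + ★ `coe_tens₀`)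
    (htens : ∀ (S : Finset (Places L)) (fS : TestS₀ L H ι T hT S) (fT : Unr₀ L H S),
      ∃ (T₁ : UnitaryGroup.PureTensor L 3 H) (T' : UnitaryGroup.PureTensor L 3 (splitForm L 3)),
        T₁.IsTest ∧ T'.IsTest ∧ T₁.eval = (toPureTensor S fS fT).eval ∧
        ⇑((ghOfFibres ι T hT (⟨traceGp, Smooth, HomogPacketG 𝔩 𝔞 μ infOf aTok, SpectralPacketH 𝔩 𝔞 𝔞H DiscH, nG, nH,
            (fun Q => Q.1.trOn S₀ (fun v => @Measure.map _ _ (borel _) _ (ψ v) (νG v)) archTrG), (fun ρ => ρ.trHOn S₀ νH archTrH), Matches⟩ : Sockets L H μGp) hg hsm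
            (fun S Q fS => Q.1.trSψ ψ S (fun v => @Measure.map _ _ (borel _) _ (ψ v) (νG v)) archTr fS) (fun S ρ fS => (σ : ℂ) * ρ.trHSψ ψ S (fun v => @Measure.map _ _ (borel _) _ (ψ v) (νG v)) archTr fS)).tensG S fS fT) = T'.eval ∧
        (∀ v, T'.loc v = T₁.loc v ∘ (ψ v).symm) ∧
        (letI : ∀ γ : UnitaryGroup.arch (↥(maximalRealSubfield L)) L (IsCMField.complexConj L) 3 H,
        MeasurableSpace (UnitaryGroup.arch (↥(maximalRealSubfield L)) L (IsCMField.complexConj L) 3 H ⧸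
          Subgroup.centralizer ({γ} : Set (UnitaryGroup.arch (↥(maximalRealSubfield L)) L (IsCMField.complexConj L) 3 H))) := fun _ => borel _
         letI : ∀ γ : UnitaryGroup.arch (↥(maximalRealSubfield L)) L (IsCMField.complexConj L) 3 (splitForm L 3),
        MeasurableSpace (UnitaryGroup.arch (↥(maximalRealSubfield L)) L (IsCMField.complexConj L) 3 (splitForm L 3) ⧸
          Subgroup.centralizer ({γ} : Set (UnitaryGroup.arch (↥(maximalRealSubfield L)) L (IsCMField.complexConj L) 3 (splitForm L 3)))) := fun _ => borel _
         IsArchInnerTransfer L H m' m T₁.arch T'.arch))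
    (htensH : ∀ (S : Finset (Places L)) (fS : TestS₀ L H ι T hT S) (fT : Unr₀ L H S),
      ∃ (T₁ : UnitaryGroup.PureTensor L 3 H) (TH : UnitaryGroup.PureTensor₂ L (splitForm L 2) (splitForm L 1)),
        T₁.IsTest ∧ TH.IsUnramified₂ ∧ (∀ v, IsLocSmooth (TH.loc v)) ∧ ArchSmooth₂ L TH.arch ∧ T₁.eval = (toPureTensor S fS fT).eval ∧
        ⇑((ghOfFibres ι T hT (⟨traceGp, Smooth, HomogPacketG 𝔩 𝔞 μ infOf aTok, SpectralPacketH 𝔩 𝔞 𝔞H DiscH, nG, nH,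
            (fun Q => Q.1.trOn S₀ (fun v => @Measure.map _ _ (borel _) _ (ψ v) (νG v)) archTrG), (fun ρ => ρ.trHOn S₀ νH archTrH), Matches⟩ : Sockets L H μGp) hg hsm
            (fun S Q fS => Q.1.trSψ ψ S (fun v => @Measure.map _ _ (borel _) _ (ψ v) (νG v)) archTr fS) (fun S ρ fS => (σ : ℂ) * ρ.trHSψ ψ S (fun v => @Measure.map _ _ (borel _) _ (ψ v) (νG v)) archTr fS)).tensH S fS fT) = TH.eval ∧
        (letI : ∀ (v : HeightOneSpectrum (𝓞 ↥(maximalRealSubfield L))) (a : (cmDatum L 2 (splitForm L 2)).Local v × (cmDatum L 1 (splitForm L 1)).Local v), MeasurableSpace (((cmDatum L 2 (splitForm L 2)).Local v × (cmDatum L 1 (splitForm L 1)).Local v) ⧸ Subgroup.centralizer ({a} : Set ((cmDatum L 2 (splitForm L 2)).Local v × (cmDatum L 1 (splitForm L 1)).Local v))) := fun _ _ => borel _;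
         letI : ∀ (v : HeightOneSpectrum (𝓞 ↥(maximalRealSubfield L))) (γ : (cmDatum L 3 H).Local v), MeasurableSpace ((cmDatum L 3 H).Local v ⧸ Subgroup.centralizer ({γ} : Set ((cmDatum L 3 H).Local v))) := fun _ _ => borel _;
         ∀ v, IsLocalDeltaTransfer L H v (Δ' v) (mH v) (mG' v) (TH.loc v) (T₁.loc v)) ∧
        (letI : ∀ a : UnitaryGroup.arch (↥(maximalRealSubfield L)) L (IsCMField.complexConj L) 2 (splitForm L 2) × UnitaryGroup.arch (↥(maximalRealSubfield L)) L (IsCMField.complexConj L) 1 (splitForm L 1), MeasurableSpace ((UnitaryGroup.arch (↥(maximalRealSubfield L)) L (IsCMField.complexConj L) 2 (splitForm L 2) × UnitaryGroup.arch (↥(maximalRealSubfield L)) L (IsCMField.complexConj L) 1 (splitForm L 1)) ⧸ Subgroup.centralizer ({a} : Set (UnitaryGroup.arch (↥(maximalRealSubfield L)) L (IsCMField.complexConj L) 2 (splitForm L 2) × UnitaryGroup.arch (↥(maximalRealSubfield L)) L (IsCMField.complexConj L) 1 (splitForm L 1)))) := fun _ => borel _;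
         letI : ∀ γ : UnitaryGroup.arch (↥(maximalRealSubfield L)) L (IsCMField.complexConj L) 3 H,
        MeasurableSpace (UnitaryGroup.arch (↥(maximalRealSubfield L)) L (IsCMField.complexConj L) 3 H ⧸
          Subgroup.centralizer ({γ} : Set (UnitaryGroup.arch (↥(maximalRealSubfield L)) L (IsCMField.complexConj L) 3 H))) := fun _ => borel _;
         IsArchDeltaTransfer L H Tinf mHi m' TH.arch T₁.arch)) :
    letI : MeasurableSpace (Gp L H).Adelic := borel _
    haveI : BorelSpace (Gp L H).Adelic := ⟨rfl⟩
    haveI : IsFiniteMeasureOnCompacts νA := hνA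
    F0P3InnerFormClassificationV8.ClassificationKit.FactorisationPk
      (kitOfRecord L H ι T hT μGp
        (⟨traceGp, Smooth, HomogPacketG 𝔩 𝔞 μ infOf aTok, SpectralPacketH 𝔩 𝔞 𝔞H DiscH, nG, nH,
          (fun Q => Q.1.trOn S₀ (fun v => @Measure.map _ _ (borel _) _ (ψ v) (νG v)) archTrG), (fun ρ => ρ.trHOn S₀ νH archTrH), Matches⟩ : Sockets L H μGp)
        (ghOfFibres ι T hT (⟨traceGp, Smooth, HomogPacketG 𝔩 𝔞 μ infOf aTok, SpectralPacketH 𝔩 𝔞 𝔞H DiscH, nG, nH,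
            (fun Q => Q.1.trOn S₀ (fun v => @Measure.map _ _ (borel _) _ (ψ v) (νG v)) archTrG), (fun ρ => ρ.trHOn S₀ νH archTrH), Matches⟩ : Sockets L H μGp) hg hsm
          (fun S Q fS => Q.1.trSψ ψ S (fun v => @Measure.map _ _ (borel _) _ (ψ v) (νG v)) archTr fS) (fun S ρ fS => (σ : ℂ) * ρ.trHSψ ψ S (fun v => @Measure.map _ _ (borel _) _ (ψ v) (νG v)) archTr fS))
        ξd μω c jInf dsInf archTr νA νG ramCls₀) S₀ := by
  letI : MeasurableSpace (Gp L H).Adelic := borel _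
  haveI : BorelSpace (Gp L H).Adelic := ⟨rfl⟩
  haveI : IsFiniteMeasureOnCompacts νA := hνA
  letI : ∀ v : HeightOneSpectrum (𝓞 ↥(maximalRealSubfield L)), MeasurableSpace ((cmDatum L 3 H).Local v) := fun _ => borel _
  haveI : ∀ v : HeightOneSpectrum (𝓞 ↥(maximalRealSubfield L)), BorelSpace ((cmDatum L 3 H).Local v) := fun _ => ⟨rfl⟩
  haveI : ∀ v : HeightOneSpectrum (𝓞 ↥(maximalRealSubfield L)), (νG v).IsMulLeftInvariant := hνl
  haveI : ∀ v : HeightOneSpectrum (𝓞 ↥(maximalRealSubfield L)), IsFiniteMeasureOnCompacts (νG v) := hνc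
  have hμK : ∀ v : HeightOneSpectrum (𝓞 ↥(maximalRealSubfield L)), (νG v).real (cmLocalIntegralLevel L 3 H v : Set ((cmDatum L 3 H).Local v)) ≠ 0 :=
    fun v => by rw [hvol v]; exact one_ne_zero
  -- (TF-1)∕S₀ for every global packet of the kit at the transported measures (★ 3y′), and (TF-ind)∕S₀ for every discrete packet (★ 3y §4)
  haveI : ∀ v : HeightOneSpectrum (𝓞 ↥(maximalRealSubfield L)), (@Measure.map _ _ (borel _) _ (ψ v) (νG v)).IsMulLeftInvariant := fun v =>
    isMulLeftInvariant_map (ψ v : (cmDatum L 3 H).Local v →ₙ* (cmDatum L 3 (splitForm L 3)).Local v) (ψ v).continuous.measurable (ψ v).surjective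
  haveI : ∀ v : HeightOneSpectrum (𝓞 ↥(maximalRealSubfield L)), IsFiniteMeasureOnCompacts (@Measure.map _ _ (borel _) _ (ψ v) (νG v)) := fun v =>
    Measure.IsFiniteMeasureOnCompacts.map (νG v) (ψ v).toHomeomorph
  have h1 : ∀ Pg : GlobalPacket 𝔩, Pg.UnramTraceOneOff S₀ (fun v => @Measure.map _ _ (borel _) _ (ψ v) (νG v)) := fun Pg =>
    Pg.unramTraceOneOff_map_of_map_eq_offS ψ νG (fun v => hadm v _) S₀ hgood hψK h4 fun v _ => hvol v
  have hind : ∀ Q : SpectralPacketG 𝔩 𝔞 μ, Q.PresentationIndepOn S₀ (fun v => @Measure.map _ _ (borel _) _ (ψ v) (νG v)) archTrG := fun Q =>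
    Q.presentationIndepOn_of_admissible S₀ (h1 Q.fin) (fun v => hadm v _) harchG
  -- `hat₀ S (germ t) fT = ∏_{v ∈ supp f^S} t_v(f^S_v)` and `vol(K′_v) = 1`
  have hhat : ∀ (S : Finset (Places L)) (t : EvpData L H) (fT : Unr₀ L H S),
      hat₀ L H S (germ L H S t) fT = ∏ v ∈ fT.T, (((νG v).real (cmLocalIntegralLevel L 3 H v : Set ((cmDatum L 3 H).Local v)) : ℂ) * t v (fT.loc v)) := by
    intro S t fT
    -- `germ` here is ★ V6's spelling of ★ V5's `germ` (definitionally the same quotient map), so ★ `hat₀_germ` is used through `rfl`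
    have h0 : hat₀ L H S (germ L H S t) fT = UnrTensor.hatOf t fT := rfl
    rw [h0, F0P3UnrTensorInstance.UnrTensor.hatOf_def]
    exact Finset.prod_congr rfl fun v _ => by rw [hvol v, Complex.ofReal_one, one_mul]
  refine ⟨fun S Q fS fT hS₀ => ⟨fun hram => ?_, fun hram => ?_⟩, fun S ρ fS fT hS₀ => ⟨fun hram => ?_, fun hram => ?_⟩⟩
  · -- (P1)-G, unramified branch: 3u″ (u5′) at the pin's `(T₁, T′)`
    obtain ⟨T₁, T', hT₁, hT', hTe, hF, hloc, harch⟩ := htens S fS fT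
    have hramG : Q.1.fin.ramFinset ⊆ S := by rw [← hξrG]; exact hram
    have key := Q.1.trOn_partner_eq_trSψ_mul_prod_of_eval_eq_offS ψ S₀ (h1 Q.1.fin) (hind Q.1) (fun v => hadm v _) hgood hψK h4 hμK S hS₀ hramG fS fT
      hT₁ hTe hT' hloc hF archTr harch' m' m hlaw harch
    refine key.trans ?_
    change _ = Q.1.trSψ ψ S (fun v => @Measure.map _ _ (borel _) _ (ψ v) (νG v)) archTr fS * hat₀ L H S (germ L H S (ξd.evpG Q)) fT
    rw [hξG, hhat]
  · -- (P1)-G, ramified branch: 3u‴ (z1′)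
    obtain ⟨T₁, T', hT₁, hT', hTe, hF, hloc, harch⟩ := htens S fS fT
    have hramG : ¬ Q.1.fin.ramFinset ⊆ S := by rw [← hξrG]; exact hram
    exact Q.1.trOn_partner_eq_zero_of_not_ramFinset_subset_of_eval_eq ψ S₀ (h1 Q.1.fin) (hind Q.1) hU (fun v => hadm v _) hgood hψK S hS₀ hramG fS fT
      hT₁ hTe hT' hloc hF archTr harch' m' m hlaw harch
  · -- (P1)-H, unramified branch: 3u″ (uH5′) at the pin's `(T₁, T^H)`
    obtain ⟨T₁, TH, hT₁, hTH, hsH, haH, hTe, hFH, hΔ, harchΔ⟩ := htensH S fS fT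
    have hramH : ρ.ramFinsetH ⊆ S := by rw [← hξrH]; exact hram
    have key := ρ.trH_partner_eq_trHSψ_mul_prod_of_eval_eq_off_signed_offS s Sbad hs ψ (fun v => hadmH v _) harchH S₀ (h1H ρ) (h1 ρ.imageG) (fun v => hadm v _) hgood hψK h4 hμK S hS₀ hramH
      fS fT hTH hsH haH hFH hT₁ hTe archTr harch' (hlawψ ρ) hΔ hlawInf harchΔ
    refine key.trans ?_
    change _ = (σ : ℂ) * ρ.trHSψ ψ S (fun v => @Measure.map _ _ (borel _) _ (ψ v) (νG v)) archTr fS * hat₀ L H S (germ L H S (ξd.evpH ρ)) fT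
    rw [hξH, hhat, hσ]
    exact (mul_assoc _ _ _).symm
  · -- (P1)-H, ramified branch: ★ 3u′ (z2) (no `G`-side law involved)
    obtain ⟨T₁, TH, hT₁, hTH, hsH, haH, hTe, hFH, hΔ, harchΔ⟩ := htensH S fS fT
    have hramH : ¬ ρ.ramFinsetH ⊆ S := by rw [← hξrH]; exact hram
    exact ρ.trH_partner_eq_zero_of_not_ramFinsetH_subset_of_eval_eq_signed_offS s ψ (fun v => hadmH v _) harchH hU (fun v => hadm v _) S₀ (h1H ρ) hgood hψK S hS₀ hramH
      fS fT hTH hsH haH hFH hT₁ hTe archTr harch' (hlawψ ρ) hΔ hlawInf harchΔ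

end Summit.HodgeConjecture.HodgeConjecture.Cruxes.H413.F0P3SpectralPacket.SpectralPacketG

end
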